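import Summits.QuantumFields.QCD.Theorems.SmallFieldUltracontractivity.Negative.Tightness
import Literature.Probability.LatticeModels.TorusFourierProofs
import Summits.QuantumFields.QCD.Theorems.HeatSlicedQuarksSmallFieldUltracontractivityStubCombGaugeAux

/-!
# Stub `stub_combGauge` of line `point-centred-axial-parabolic`
(crux `Summit.QuantumFields.QCD.Theses.HeatSlicedQuarks.SmallFieldUltracontractivity`, item stmt-QuantumFields-8871)

**Comb (complete axial) gauge on a non-wrapping cube.**  On the `L⁴` torus with `2R + 1 ≤ L`, if every
plaquette based in the `torusDist`-ball of radius `R` about `x` has deficit `3 - Re tr U_p ≤ δ²`, then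
there is a gauge `g` such that every link `(z, μ)` with `torusDist x z + 1 ≤ R` has gauge-transformed
deficit `3 - Re tr (g • U)(z, μ) ≤ 16 (torusDist x z + 1)² δ²`.

Proof.  Sites of the cube are parametrised by offsets `m ∈ {0, …, 2R}⁴` from the corner
`x₀ = x - (R,R,R,R)`, the centre being `m = (R,R,R,R)`.  The gauge `g(z)` is the holonomy of the comb
path from the centre to `z` (axis `0` first, then `1`, `2`, `3`), each axial segment being written as
`ℓ_k(R)⁻¹ ℓ_k(m_k)` with straight holonomies `ℓ_k` started on the face `{m_k = 0}`, which handles both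
orientations at once; links on the comb tree are gauged to `1` (`exists_treeGauge`, the only
construction of this file, kept definition-free).  The rest is the registered sub-goal
`stub_combGaugeAxial` of the helper file `HeatSlicedQuarksSmallFieldUltracontractivityStubCombGaugeAux.lean`
(namespace `…PointCentredAxialParabolic.CombGauge` for its riders): the transport identity
`W(y + ν̂, μ) = Ad_{g y}(U_p(y; ν, μ)) · W(y, μ)` moves a non-tree link along the axes `ν > μ` onto the
tree at the cost of one plaquette per step, at most `4 d` steps in all, `d = torusDist x z`; costs are
measured by the Frobenius distance to the identity `F(V) = ‖V - 1‖_F` (subadditive on unitaries,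
conjugation invariant, `F(V)² = 2 (3 - Re tr V)` on `SU(3)`), whence
`3 - Re tr W ≤ ½ (4 d √2 δ)² = 16 d² δ²`.
-/

noncomputable section

namespace Summit.QuantumFields.QCD.Cruxes.SmallFieldUltracontractivity.PointCentredAxialParabolic

open Literature.MathematicalPhysics.QuantumLattice Literature.MathematicalPhysics.QuantumFieldTheory
open Literature.Probability.LatticeModels (TorusSite torusChar)
open Summit.QuantumFields.QCD.Theorems.SmallFieldUltracontractivity.Negative
open scoped Matrix ComplexConjugate

/-- **The comb tree gauge (definition-free form).**  For every configuration `U`, corner `x₀` and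
centre value `R` there is a gauge `g` (the holonomy of the comb path from the centre offset
`(R,R,R,R)`: axis `0` first, then `1, 2, 3`) such that every link `(x₀ + q, μ)` whose offset `q` is
central in all coordinates after `μ` (a link of the comb tree) is gauged to `1`. -/
private theorem exists_treeGauge {G : Type*} [Group G] {L : ℕ} (U : GaugeConfig 4 L G)
    (x₀ : TorusSite 4 L) (R : ℕ) :
    ∃ g : TorusSite 4 L → G, ∀ (q : Fin 4 → ℕ) (μ : Fin 4), (∀ i, q i < L) → q μ + 1 < L →
      (∀ i, μ < i → q i = R) → gaugeTransform g U (x₀ + (fun i => (q i : ZMod L)), μ) = 1 := by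
  -- feet of the axial segments, axial transports `ℓ_k(R)⁻¹ ℓ_k(m_k)` and the comb (local definitions)
  let foot : (Fin 4 → ℕ) → Fin 4 → Fin 4 → ℕ :=
    fun m k i => if i < k then m i else if i = k then 0 else R
  let A : (Fin 4 → ℕ) → Fin 4 → G := fun m k =>
    (lineHolonomy U k R (x₀ + fun i => (foot m k i : ZMod L)))⁻¹ *
      lineHolonomy U k (m k) (x₀ + fun i => (foot m k i : ZMod L))
  let comb : (Fin 4 → ℕ) → G := fun m => A m 0 * A m 1 * A m 2 * A m 3
  refine ⟨fun z => comb (fun i => ((z - x₀) i).val), fun q μ hq hqμ htree => ?_⟩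
  -- offsets of cube sites
  have hval : ∀ m : Fin 4 → ℕ, (∀ i, m i < L) →
      (fun i => (((x₀ + fun j => (m j : ZMod L)) - x₀) i).val) = m := by
    intro m hm; funext i; simp only [add_sub_cancel_left]; exact ZMod.val_cast_of_lt (hm i)
  have hshift : (x₀ + fun i => ((q + Pi.single μ 1 : Fin 4 → ℕ) i : ZMod L)) =
      Site.shift (x₀ + fun i => (q i : ZMod L)) μ := by
    simp only [Site.shift]; rw [add_assoc]; congr 1; funext i
    by_cases h : i = μ
    · subst h; simp
    · simp [Pi.single_eq_of_ne h]
  have hq' : ∀ i, (q + Pi.single μ 1 : Fin 4 → ℕ) i < L := by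
    intro i
    by_cases h : i = μ
    · subst h; simpa using hqμ
    · simpa [Pi.single_eq_of_ne h] using hq i
  -- the feet of the axes `k ≤ μ` do not see the step
  have hfoot : ∀ k, k ≤ μ → foot (q + Pi.single μ 1) k = foot q k := by
    intro k hk; funext i; simp only [foot]
    by_cases hik : i < k
    · simp [hik, Pi.single_eq_of_ne (lt_of_lt_of_le hik hk).ne]
    · simp [hik]
  have hlt : ∀ k, k < μ → A (q + Pi.single μ 1) k = A q k := by
    intro k hk
    have : (q + Pi.single μ 1 : Fin 4 → ℕ) k = q k := by simp [Pi.single_eq_of_ne hk.ne]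
    simp only [A]; rw [hfoot k hk.le, this]
  have hgt : ∀ k, μ < k → A q k = 1 := by
    intro k hk; simp only [A]; rw [htree k hk, inv_mul_cancel]
  have hgt' : ∀ k, μ < k → A (q + Pi.single μ 1) k = 1 := by
    intro k hk
    have e : (q + Pi.single μ 1 : Fin 4 → ℕ) k = R := by simp [Pi.single_eq_of_ne hk.ne', htree k hk]
    simp only [A]; rw [e, inv_mul_cancel]
  have hself : A (q + Pi.single μ 1) μ = A q μ * U (x₀ + (fun i => (q i : ZMod L)), μ) := by
    have h1 : (q + Pi.single μ 1 : Fin 4 → ℕ) μ = q μ + 1 := by simp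
    simp only [A]; rw [hfoot μ le_rfl, h1, WilsonLoopRP.lineHolonomy_succ_right, mul_assoc]
    congr 3
    rw [add_assoc]; congr 1; funext i
    simp only [foot, Pi.add_apply, Pi.single_apply]
    by_cases hi : i < μ
    · simp [hi, hi.ne]
    · by_cases he : i = μ
      · subst he; simp
      · simp [hi, he, htree i (lt_of_le_of_ne (not_lt.mp hi) (Ne.symm he))]
  -- the comb extends by the link
  have hcomb : comb (q + Pi.single μ 1) = comb q * U (x₀ + (fun i => (q i : ZMod L)), μ) := by
    simp only [comb]
    obtain ⟨k, hk⟩ := μ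
    interval_cases k
    · have e : (⟨0, hk⟩ : Fin 4) = 0 := rfl
      simp only [e] at hself hgt hgt' ⊢
      rw [hself, hgt' 1 (by decide), hgt' 2 (by decide), hgt' 3 (by decide), hgt 1 (by decide),
        hgt 2 (by decide), hgt 3 (by decide)]
      simp only [mul_one]
    · have e : (⟨1, hk⟩ : Fin 4) = 1 := rfl
      simp only [e] at hself hlt hgt hgt' ⊢
      rw [hlt 0 (by decide), hself, hgt' 2 (by decide), hgt' 3 (by decide), hgt 2 (by decide),
        hgt 3 (by decide)]
      simp only [mul_one, mul_assoc]
    · have e : (⟨2, hk⟩ : Fin 4) = 2 := rfl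
      simp only [e] at hself hlt hgt hgt' ⊢
      rw [hlt 0 (by decide), hlt 1 (by decide), hself, hgt' 3 (by decide), hgt 3 (by decide)]
      simp only [mul_one, mul_assoc]
    · have e : (⟨3, hk⟩ : Fin 4) = 3 := rfl
      simp only [e] at hself hlt ⊢
      rw [hlt 0 (by decide), hlt 1 (by decide), hlt 2 (by decide), hself]
      simp only [mul_assoc]
  -- conclusion
  simp only [gaugeTransform]
  rw [← hshift, hval q hq, hval _ hq', hcomb, mul_inv_rev, ← mul_assoc, mul_inv_cancel_right,
    mul_inv_cancel]

open scoped Matrix.Norms.Frobenius in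
/-- **Comb gauge** (complete axial gauge on a non-wrapping cube).  There is an absolute constant
`C_A` (here `16`) such that on every `L⁴` torus, for every `SU(3)` configuration `U`, centre `x` and
radius `R` with `2R + 1 ≤ L` (the cube does not wrap): if all plaquettes based in the ball
`torusDist x · ≤ R` have deficit `3 - Re tr U_p ≤ δ²`, then after a gauge transformation every link
`(z, μ)` with `torusDist x z + 1 ≤ R` has deficit `≤ C_A (torusDist x z + 1)² δ²` — plaquette
smallness gives link smallness growing linearly with the distance from the centre. -/
theorem stub_combGauge :
    ∃ C_A : ℝ, ∀ (L : ℕ) [NeZero L] (U : GaugeConfig 4 L SU3) (x : TorusSite 4 L) (R : ℕ),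
      2 * R + 1 ≤ L → ∀ δ : ℝ, 0 ≤ δ →
      (∀ y : TorusSite 4 L, torusDist x y ≤ R → ∀ μ ν : Fin 4,
        3 - ((fundamentalRep (Fin 3)) (plaquetteHolonomy U y μ ν)).trace.re ≤ δ ^ 2) →
      ∃ g : TorusSite 4 L → SU3, ∀ z : TorusSite 4 L, torusDist x z + 1 ≤ R → ∀ μ : Fin 4,
        3 - ((fundamentalRep (Fin 3)) (gaugeTransform g U (z, μ))).trace.re
          ≤ C_A * ((torusDist x z : ℝ) + 1) ^ 2 * δ ^ 2 := by
  refine ⟨16, fun L _ U x R hRL δ hδ hyp => ?_⟩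
  -- the corner of the cube, its sites by offsets, and the comb tree gauge
  set x₀ : TorusSite 4 L := x - fun _ : Fin 4 => (R : ZMod L) with hx₀
  set site : (Fin 4 → ℕ) → TorusSite 4 L := fun m => x₀ + fun i => (m i : ZMod L) with hsitedef
  obtain ⟨g, hg⟩ := exists_treeGauge U x₀ R
  refine ⟨g, fun z hz μ => ?_⟩
  -- the cost function `F = ‖· - 1‖_F` and the per-plaquette cost `η = √2 δ`
  set F : SU3 → ℝ := fun V => ‖(V : Matrix (Fin 3) (Fin 3) ℂ) - 1‖ with hF
  set η : ℝ := Real.sqrt 2 * δ with hηdef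
  have hη0 : 0 ≤ η := by positivity
  have hη2 : η ^ 2 = 2 * δ ^ 2 := by
    rw [hηdef, mul_pow, Real.sq_sqrt (by norm_num : (0 : ℝ) ≤ 2)]
  have hη : ∀ y, torusDist x y ≤ R → ∀ μ ν : Fin 4, F (plaquetteHolonomy U y μ ν) ≤ η := by
    intro y hy μ ν
    have h := hyp y hy μ ν
    rw [fundamentalRep_apply] at h
    have hsq : F (plaquetteHolonomy U y μ ν) ^ 2 ≤ η ^ 2 := by
      rw [hF, CombGauge.norm_sub_one_sq, hη2]; linarith
    exact (sq_le_sq₀ (norm_nonneg _) hη0).mp hsq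
  -- geometry of the cube: steps and the centre `(R,R,R,R)`
  have hsite : ∀ (m : Fin 4 → ℕ) (μ : Fin 4), site (m + Pi.single μ 1) = Site.shift (site m) μ := by
    intro m μ
    simp only [hsitedef, Site.shift]
    rw [add_assoc]
    congr 1
    funext i
    by_cases h : i = μ
    · subst h; simp
    · simp [Pi.single_eq_of_ne h]
  have hcentre : site (fun _ => R) = x := sub_add_cancel _ _
  have hdist : ∀ q : Fin 4 → ℕ, (∀ i, R ≤ q i + R ∧ q i ≤ R + R) → torusDist x (site q) ≤ R := by
    intro q hq
    rw [← hcentre]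
    exact CombGauge.torusDist_add_natCast_le x₀ _ q R hq
  -- the axial induction of the helper file, for the tree gauge and the Frobenius cost
  set D := torusDist x z with hD
  have key := stub_combGaugeAxial L U x R η site g F hRL hη0 (by simp [hF]) hη hsite hdist hg
    (fun y ν μ' h1 h2 => CombGauge.norm_transport g U y ν μ' h1 h2) D hz μ
    (fun i => ((z - x₀) i).val) (fun i => CombGauge.offset_bounds x R hRL z hz i)
  have hzm : site (fun i => ((z - x₀) i).val) = z := by
    have : (fun i => ((((z - x₀) i).val : ℕ) : ZMod L)) = z - x₀ :=
      funext fun i => ZMod.natCast_zmod_val _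
    simp only [hsitedef]
    rw [this, add_sub_cancel]
  rw [hzm] at key
  -- convert the Frobenius bound into the trace deficit
  rw [fundamentalRep_apply]
  have hsq := CombGauge.norm_sub_one_sq (gaugeTransform g U (z, μ))
  have hk' : F (gaugeTransform g U (z, μ)) ^ 2 ≤ (4 * (D * η)) ^ 2 :=
    pow_le_pow_left₀ (norm_nonneg _) key 2
  rw [hF] at hk'
  have hD0 : (0 : ℝ) ≤ D := by positivity
  nlinarith [hsq, hk', hη2, sq_nonneg δ, hD0, sq_nonneg (D : ℝ)]

end Summit.QuantumFields.QCD.Cruxes.SmallFieldUltracontractivity.PointCentredAxialParabolic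

end
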